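import Literature.MathematicalPhysics.QuantumFieldTheory.Balaban1983to89.B16Prop1IVAnalytic
import Literature.MathematicalPhysics.QuantumFieldTheory.Balaban1983to89.B16Ineq141Solution

/-!
# `Balaban1983to89.B16Prop1IVInverseC` — [Balaban1989LargeFieldII] p. 359: *«By the inequality (1.9) the operator
P₀H*_{1,k}Δ₁H_{1,k}P₀ is positive, hence invertible on this subspace, and the inverse is bounded by γ₀⁻¹2d(100M)⁵»* for
𝔤ᶜ-VALUED FIELDS (*«The above equations, bounds and statements are valid for 𝔤ᶜ-valued fields»*) — the inverse DERIVED in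
the complex model, and fed to the (1.13) and (1.40)/(1.41) analyticity theorems

T. Bałaban, *Large field renormalization. II. Localization, exponentiation, and bounds for the 𝐑 operation*, Commun.
Math. Phys. **122** (1989) 355–392 [Balaban1989LargeFieldII] (cell paper B16; PDF held
`paper:balaban1989-cmp122-large-field-ii`, journal page = PDF page + 354; p. 359 = PDF 5, text layer `p0005.txt` L13–L25;
p. 367 = PDF 13).

statement-level skeleton of published theorems with citation tags; proofs where landed; nothing here is a claim about
the Yang–Mills mass gap

CITATION HEADER / WHAT IS REPRODUCED.  Mega-formalization `lit-balaban`, HOME `run/shared/lean/pub/lit-balaban/`;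
reader/typer **r13 gen 17** (B16 display-level owner; rows `lit-balaban-r13/ROWS-B16.md`).  SKELETON rows
**B16.Prop1[IV]** (the p. 359 proof of Proposition 1 [IV]), **B16.Eq1.41** ((1.40)/(1.41) p. 367), B16.Eq1.13, B16.Eq1.9.
p. 359, verbatim (text layer L13–L25): *«Denote by P₀ the projection onto the subspace of B′ satisfying the gauge
condition B′↾_{G₀} = 0. By the inequality (1.9) the operator P₀H*_{1,k}Δ₁H_{1,k}P₀ is positive, hence invertible on this
subspace, and the inverse is bounded by γ₀⁻¹2d(100M)⁵. Equation (1.12) can be written as … (1.13) … The above equations,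
bounds and statements are valid for 𝔤ᶜ-valued fields, hence the existence of the analytic extension follows immediately,
and Proposition 1 [IV] is proved.»*  p. 367: *«inverting the linear operator as in (1.13), we obtain the equation (1.40)
… We can prove again that Eq. (1.40) has exactly one solution B′_Λ(B̃′), which is an analytic function of the 𝔤ᶜ-valued
small field B̃′, satisfying the bound (1.41)»*.

STATE OF THE TREE BEFORE THIS FILE.  Over `ℝ` the inverse is DERIVED from the (1.9) positivity for a finite-dimensional
field space (`…B16Prop1IVAssembly.exists_inverse_of_pos`, r13 gen 16).  The two COMPLEX files of these rows —
`…B16Prop1IVAnalytic` ((1.13): `exists_analytic_solution113`, `prop1IV_analytic_in_J`) and `…B16Ineq141Solution`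
((1.40)/(1.41): `exists_analytic_solution140`, `exactlyOne141`) — still take the inverse `Kinv : E →L[ℂ] E` and its bound
`‖Kinv P₀ H* z‖ ≦ κ₁‖z‖` as DATA.  THIS FILE proves the p. 359 sentence in the complex model and removes that datum:
* §1 **`norm_proj_le`**, **`exists_inverse_of_pos`** over any `RCLike` scalar field `𝕜` (so `𝕜 = ℝ` is gen 16's theorem
  restated for bounded operators, `𝕜 = ℂ` the 𝔤ᶜ-valued case): for a finite-dimensional inner-product space `E` of bond
  fields (the physical `E` = 𝔤ᶜ-valued fields on the finite box `Λ`), `P₀` an idempotent symmetric projection, `H* = Hst`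
  the adjoint of `H`, and the (1.9)-shaped positivity **`c‖B′‖² ≦ re ⟨H B′, Δ₁ H B′⟩` on the gauge subspace** — exactly
  what (1.9) gives for 𝔤ᶜ-valued `B′ = X + iY` (for the complexification of the real form, `re ⟨(X+iY), K(X+iY)⟩ =
  ⟨X, KX⟩ + ⟨Y, KY⟩ ≧ c(‖X‖² + ‖Y‖²)`; `c = γ₀/(2d(100M)⁵)` in print) — there is a bounded `𝕜`-linear `Kinv` with
  `Kinv(K(P₀x)) = P₀x`, `K(Kinv x) = P₀x`, `Kinv ∘ P₀ = Kinv`, `P₀ ∘ Kinv = Kinv` (`K = P₀HstΔ₁H`) AND the printed bound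
  `‖Kinv x‖ ≦ c⁻¹‖P₀x‖` (*«the inverse is bounded by γ₀⁻¹2d(100M)⁵»*); hence `‖Kinv P₀ Hst z‖ ≦ c⁻¹·hst·‖z‖`
  (`kinv_comp_bound`).
* §2 **`prop1IV_analytic_of_pos`** — `…B16Prop1IVAnalytic.prop1IV_analytic_in_J` with `Kinv`, `hKop` DISCHARGED: from
  (1.9) (`hpos`), `‖H‖ ≦ h₁`, `‖H*‖ ≦ hst`, Proposition 4 [15] (`dV 0 = 0`, `ℓ`-Lipschitz and analytic on `‖u‖ < ρ`) and
  `c⁻¹hst·ℓ·h₁ ≦ ½`: an inverse as in §1 and the critical configuration `B′(J)` analytic in the current `J`, solving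
  (1.13), `‖B′(J)‖ ≦ 2‖Kinv P₀ H* J‖`.
* §3 **`exists_analytic_solution140_of_pos`**, **`exactlyOne141_of_pos`** — the same for (1.40)/(1.41):
  `…B16Ineq141Solution.exists_analytic_solution140` / `exactlyOne141` with `Kinv`, `hKop` DISCHARGED, `κ₁ = c⁻¹·hst`;
  for (1.41) AS TYPED (`B16Sect1Statements.Ineq141`, constant `4d(100M)⁵γ₀⁻¹B₃²`) the bookkeeping is
  `c = γ₀/(2d(100M)⁵)` ((1.9)) and `hst·b ≦ B₃²` (print's `B₃²` bounds `H*Δ₁H`; `‖Δ₁Hx‖ ≦ b‖x‖`, `‖H*z‖ ≦ hst‖z‖`).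
Theorems only; no `sorry`; no new definition, no `… : Prop` fact; Mathlib (`LinearEquiv.ofInjectiveEndo`,
`LinearMap.toContinuousLinearMap`) + the two r13 files.
HONEST SCOPE.  Finite dimension of `E` is used for «positive ⇒ invertible» (in print all field spaces are
finite-dimensional); (1.9) itself stays the typed leaf / box-chart theorem of row B16.Eq1.9 and enters as `hpos`; the
operators `H_{1,k}`, `Δ₁(ζ₀)`, `P₀`, the functional `V`, Proposition 4 [15] are abstract data / hypotheses as in every
file of these rows; analyticity is in `J` resp. `B̃′` only (operators fixed).  NOT summit progress.
-/

noncomputable section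

namespace Literature.MathematicalPhysics.QuantumFieldTheory.Balaban1983to89.B16Prop1IVInverseC

open Metric
open scoped InnerProductSpace
open Literature.MathematicalPhysics.QuantumFieldTheory.Balaban1983to89

/-! ## §1. «positive, hence invertible on this subspace, and the inverse is bounded by γ₀⁻¹2d(100M)⁵» — `RCLike` scalars -/

section Inverse

variable {𝕜 : Type*} [RCLike 𝕜] {E F : Type*} [NormedAddCommGroup E] [InnerProductSpace 𝕜 E]
  [NormedAddCommGroup F] [InnerProductSpace 𝕜 F]

/-- `‖P₀ y‖ ≤ ‖y‖` for an idempotent symmetric `P₀` (the orthogonal gauge projection), `RCLike` scalars.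
[cite: Balaban1989LargeFieldII, p.359 («Denote by P₀ the projection onto the subspace of B′ satisfying the gauge
condition»)] -/
theorem norm_proj_le (P₀ : E →L[𝕜] E) (hP2 : ∀ x, P₀ (P₀ x) = P₀ x)
    (hPsa : ∀ x y, ⟪P₀ x, y⟫_𝕜 = ⟪x, P₀ y⟫_𝕜) (y : E) : ‖P₀ y‖ ≤ ‖y‖ := by
  have h : ‖P₀ y‖ ^ 2 ≤ ‖y‖ * ‖P₀ y‖ := by
    calc ‖P₀ y‖ ^ 2 = RCLike.re ⟪P₀ y, P₀ y⟫_𝕜 := (inner_self_eq_norm_sq _).symm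
      _ = RCLike.re ⟪y, P₀ (P₀ y)⟫_𝕜 := by rw [hPsa]
      _ = RCLike.re ⟪y, P₀ y⟫_𝕜 := by rw [hP2]
      _ ≤ ‖y‖ * ‖P₀ y‖ := re_inner_le_norm _ _
  by_cases h0 : ‖P₀ y‖ = 0
  · rw [h0]; exact norm_nonneg _
  · have hp : 0 < ‖P₀ y‖ := lt_of_le_of_ne (norm_nonneg _) (Ne.symm h0)
    nlinarith

/-- **«By the inequality (1.9) the operator P₀H*Δ₁HP₀ is positive, hence invertible on this subspace, and the inverse is
bounded by γ₀⁻¹2d(100M)⁵» (p. 359), «valid for 𝔤ᶜ-valued fields»** — PROVED over any `RCLike` field `𝕜` for a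
finite-dimensional `E`: from `c‖x‖² ≤ re ⟨Hx, Δ₁Hx⟩` on the gauge subspace `{x | P₀x = x}` (`c > 0`; (1.9) with
`c = γ₀/(2d(100M)⁵)`, for 𝔤ᶜ-valued fields the real part of the complexified form), `Hst` the adjoint of `H`, `P₀`
idempotent symmetric, there is a bounded linear `Kinv` — the inverse of `K = P₀HstΔ₁HP₀` on the gauge subspace composed
with `P₀` — with `Kinv(K(P₀x)) = P₀x`, `K(Kinv x) = P₀x`, `Kinv ∘ P₀ = Kinv`, `P₀ ∘ Kinv = Kinv` and `‖Kinv x‖ ≤ c⁻¹‖P₀x‖`.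
(`𝕜 = ℝ`: `…B16Prop1IVAssembly.exists_inverse_of_pos`, gen 16, for bounded operators.)
[cite: Balaban1989LargeFieldII, p.359 (between (1.12) and (1.13), and the closing sentence of the proof); (1.9) p.358] -/
theorem exists_inverse_of_pos [FiniteDimensional 𝕜 E] (P₀ : E →L[𝕜] E) (hP2 : ∀ x, P₀ (P₀ x) = P₀ x)
    (hPsa : ∀ x y, ⟪P₀ x, y⟫_𝕜 = ⟪x, P₀ y⟫_𝕜) (H : E →L[𝕜] F) (Hst : F →L[𝕜] E)
    (hadj : ∀ (x : E) (y : F), ⟪H x, y⟫_𝕜 = ⟪x, Hst y⟫_𝕜) (Δ₁ : F →L[𝕜] F) {c : ℝ} (hc : 0 < c)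
    (hpos : ∀ x, P₀ x = x → c * ‖x‖ ^ 2 ≤ RCLike.re ⟪H x, Δ₁ (H x)⟫_𝕜) :
    ∃ Kinv : E →L[𝕜] E, (∀ x, Kinv (P₀ (Hst (Δ₁ (H (P₀ x))))) = P₀ x) ∧
      (∀ x, P₀ (Hst (Δ₁ (H (P₀ (Kinv x))))) = P₀ x) ∧ (∀ x, Kinv (P₀ x) = Kinv x) ∧
      (∀ x, P₀ (Kinv x) = Kinv x) ∧ ∀ x, ‖Kinv x‖ ≤ c⁻¹ * ‖P₀ x‖ := by
  -- the gauge subspace `V = range P₀ = {x | P₀ x = x}` and `K = P₀ Hst Δ₁ H` restricted to it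
  set P : E →ₗ[𝕜] E := (P₀ : E →ₗ[𝕜] E) with hP
  have hP_apply : ∀ x, P x = P₀ x := fun x => rfl
  set V : Submodule 𝕜 E := LinearMap.range P with hV
  have hmemV : ∀ {x : E}, x ∈ V → P₀ x = x := by
    rintro x ⟨y, rfl⟩; exact hP2 y
  set Kf : E →ₗ[𝕜] E := ((P₀.comp (Hst.comp (Δ₁.comp H)) : E →L[𝕜] E) : E →ₗ[𝕜] E) with hKf
  have hKf_apply : ∀ x, Kf x = P₀ (Hst (Δ₁ (H x))) := fun x => rfl
  have hmaps : ∀ v ∈ V, Kf v ∈ V := fun v _ => ⟨Hst (Δ₁ (H v)), rfl⟩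
  set K' : V →ₗ[𝕜] V := Kf.restrict hmaps with hK'
  have hK'_coe : ∀ v : V, ((K' v : V) : E) = P₀ (Hst (Δ₁ (H (v : E)))) := fun v => rfl
  -- coercivity of `K'` on `V` (this is where (1.9), the adjoint and the symmetry of `P₀` enter)
  have hcoer : ∀ v : V, c * ‖(v : E)‖ ^ 2 ≤ RCLike.re ⟪(v : E), ((K' v : V) : E)⟫_𝕜 := by
    intro v
    have hv : P₀ (v : E) = v := hmemV v.2
    calc c * ‖(v : E)‖ ^ 2 ≤ RCLike.re ⟪H (v : E), Δ₁ (H (v : E))⟫_𝕜 := hpos _ hv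
      _ = RCLike.re ⟪(v : E), Hst (Δ₁ (H (v : E)))⟫_𝕜 := by rw [hadj]
      _ = RCLike.re ⟪P₀ (v : E), Hst (Δ₁ (H (v : E)))⟫_𝕜 := by rw [hv]
      _ = RCLike.re ⟪(v : E), P₀ (Hst (Δ₁ (H (v : E))))⟫_𝕜 := by rw [hPsa]
      _ = RCLike.re ⟪(v : E), ((K' v : V) : E)⟫_𝕜 := by rw [hK'_coe]
  -- the bound `c‖v‖ ≤ ‖K' v‖`, hence injectivity
  have hlow : ∀ v : V, c * ‖(v : E)‖ ≤ ‖((K' v : V) : E)‖ := by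
    intro v
    have h1 := hcoer v
    have h2 : RCLike.re ⟪(v : E), ((K' v : V) : E)⟫_𝕜 ≤ ‖(v : E)‖ * ‖((K' v : V) : E)‖ := re_inner_le_norm _ _
    by_cases h0 : ‖(v : E)‖ = 0
    · rw [h0, mul_zero]; exact norm_nonneg _
    · have hp : 0 < ‖(v : E)‖ := lt_of_le_of_ne (norm_nonneg _) (Ne.symm h0)
      nlinarith
  have hinj : Function.Injective K' := by
    intro v w hvw
    have h0 : K' (v - w) = 0 := by rw [map_sub, hvw, sub_self]
    have h1 := hlow (v - w)
    rw [h0] at h1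
    simp only [ZeroMemClass.coe_zero, norm_zero] at h1
    have h2 : ‖((v - w : V) : E)‖ ≤ 0 := by nlinarith [norm_nonneg ((v - w : V) : E)]
    have h3 : ((v - w : V) : E) = 0 := norm_le_zero_iff.mp h2
    exact sub_eq_zero.mp (by exact_mod_cast h3)
  set Keq : V ≃ₗ[𝕜] V := LinearEquiv.ofInjectiveEndo K' hinj with hKeq
  have hKeq_apply : ∀ v : V, Keq v = K' v := fun v => rfl
  -- `Kinv = ι ∘ K'⁻¹ ∘ (P₀ as a map into V)`, a bounded operator (finite dimension)
  set R : E →ₗ[𝕜] V := P.rangeRestrict with hR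
  have hR_coe : ∀ x, ((R x : V) : E) = P₀ x := fun x => rfl
  set Kl : E →ₗ[𝕜] E := V.subtype ∘ₗ (Keq.symm : V →ₗ[𝕜] V) ∘ₗ R with hKl
  have hKl_apply : ∀ x, Kl x = ((Keq.symm (R x) : V) : E) := fun x => rfl
  refine ⟨LinearMap.toContinuousLinearMap Kl, ?_, ?_, ?_, ?_, ?_⟩
  · -- `Kinv (K (P₀ x)) = P₀ x`
    intro x
    have hRx : R (P₀ (Hst (Δ₁ (H (P₀ x))))) = K' (R x) := by
      apply Subtype.ext
      rw [hR_coe, hK'_coe, hR_coe, hP2]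
    rw [LinearMap.coe_toContinuousLinearMap', hKl_apply, hRx, ← hKeq_apply, LinearEquiv.symm_apply_apply, hR_coe]
  · -- `K (Kinv x) = P₀ x`
    intro x
    rw [LinearMap.coe_toContinuousLinearMap', hKl_apply, hmemV (Keq.symm (R x)).2, ← hK'_coe, ← hKeq_apply,
      LinearEquiv.apply_symm_apply, hR_coe]
  · -- `Kinv (P₀ x) = Kinv x`
    intro x
    have hRx : R (P₀ x) = R x := by apply Subtype.ext; rw [hR_coe, hR_coe, hP2]
    rw [LinearMap.coe_toContinuousLinearMap', hKl_apply, hKl_apply, hRx]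
  · -- `P₀ (Kinv x) = Kinv x`
    intro x
    rw [LinearMap.coe_toContinuousLinearMap', hKl_apply]
    exact hmemV (Keq.symm (R x)).2
  · -- the printed bound `‖K⁻¹ w‖ ≤ c⁻¹ ‖w‖` on the gauge subspace
    intro x
    rw [LinearMap.coe_toContinuousLinearMap', hKl_apply]
    have h1 := hlow (Keq.symm (R x))
    rw [← hKeq_apply, LinearEquiv.apply_symm_apply, hR_coe] at h1
    rw [le_inv_mul_iff₀ hc]
    exact h1

/-- The operator bound of the composite `Kinv P₀ H*` used by the (1.13)/(1.40) contraction schemes: from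
`‖Kinv x‖ ≤ c⁻¹‖P₀x‖` (the inverse bound of p. 359), `P₀` idempotent symmetric and `‖H* z‖ ≤ hst‖z‖`,
`‖Kinv P₀ H* z‖ ≤ c⁻¹·hst·‖z‖` (`κ₁ = γ₀⁻¹2d(100M)⁵·‖H*‖`). [cite: Balaban1989LargeFieldII, p.359 (after (1.13): «a bound
of the right-hand side»)] -/
theorem kinv_comp_bound (P₀ : E →L[𝕜] E) (hP2 : ∀ x, P₀ (P₀ x) = P₀ x)
    (hPsa : ∀ x y, ⟪P₀ x, y⟫_𝕜 = ⟪x, P₀ y⟫_𝕜) (Hst : F →L[𝕜] E) (Kinv : E →L[𝕜] E) {c hst : ℝ} (hc : 0 < c)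
    (hbd : ∀ x, ‖Kinv x‖ ≤ c⁻¹ * ‖P₀ x‖) (hHst : ∀ z : F, ‖Hst z‖ ≤ hst * ‖z‖) (z : F) :
    ‖Kinv (P₀ (Hst z))‖ ≤ c⁻¹ * hst * ‖z‖ := by
  calc ‖Kinv (P₀ (Hst z))‖ ≤ c⁻¹ * ‖P₀ (P₀ (Hst z))‖ := hbd _
    _ = c⁻¹ * ‖P₀ (Hst z)‖ := by rw [hP2]
    _ ≤ c⁻¹ * ‖Hst z‖ := mul_le_mul_of_nonneg_left (norm_proj_le P₀ hP2 hPsa _) (inv_nonneg.mpr hc.le)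
    _ ≤ c⁻¹ * (hst * ‖z‖) := mul_le_mul_of_nonneg_left (hHst z) (inv_nonneg.mpr hc.le)
    _ = c⁻¹ * hst * ‖z‖ := by ring

end Inverse

/-! ## §2. Proposition 1 [IV] in the complex model with the inverse DERIVED: (1.13), analytic in the current `J` -/

section Consumers

variable {E F : Type*} [NormedAddCommGroup E] [InnerProductSpace ℂ E] [FiniteDimensional ℂ E]
  [NormedAddCommGroup F] [InnerProductSpace ℂ F]

/-- **Proposition 1 [IV], p. 359, complex model, inverse from (1.9).**  `…B16Prop1IVAnalytic.prop1IV_analytic_in_J` with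
its data `Kinv` and hypothesis `‖Kinv P₀ H* z‖ ≦ κ₁‖z‖` DISCHARGED by `exists_inverse_of_pos` / `kinv_comp_bound`
(`κ₁ = c⁻¹·hst`): from the (1.9) positivity `c‖B′‖² ≦ re ⟨HB′, Δ₁HB′⟩` on the gauge subspace (`c = γ₀/(2d(100M)⁵)`),
`P₀` idempotent symmetric, `H* = Hst` the adjoint of `H`, `‖H‖ ≦ h₁`, `‖H*‖ ≦ hst`, Proposition 4 [15] (`dV 0 = 0`, `dV`
`ℓ`-Lipschitz on `‖u‖ ≦ ρ` and analytic on `‖u‖ < ρ`), the room `h₁·3r ≦ ρ` and the smallness `c⁻¹hst·ℓ·h₁ ≦ ½`: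
there is a bounded inverse `Kinv` of `P₀H*Δ₁HP₀` on the gauge subspace with the printed bound, and a critical configuration
`B′(J)`, `ℂ`-analytic at every current `J` with `‖Kinv P₀ H* J‖ < r`, solving (1.13)
`B′ + Kinv P₀ H* dV(H B′) = −Kinv P₀ H* J` with `‖B′(J)‖ ≦ 2‖Kinv P₀ H* J‖` (*«exactly one solution, which has a bound
equal to twice a bound of the right-hand side … valid for 𝔤ᶜ-valued fields, hence the existence of the analytic extension
follows immediately, and Proposition 1 [IV] is proved»*). [cite: Balaban1989LargeFieldII, p.359 (proof of
Proposition 1 [IV]); (1.9) p.358; Balaban1985Variational, Prop. 4] -/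
theorem prop1IV_analytic_of_pos (P₀ : E →L[ℂ] E) (hP2 : ∀ x, P₀ (P₀ x) = P₀ x)
    (hPsa : ∀ x y, ⟪P₀ x, y⟫_ℂ = ⟪x, P₀ y⟫_ℂ) (H : E →L[ℂ] F) (Hst : F →L[ℂ] E)
    (hadj : ∀ (x : E) (y : F), ⟪H x, y⟫_ℂ = ⟪x, Hst y⟫_ℂ) (Δ₁ : F →L[ℂ] F) {c : ℝ} (hc : 0 < c)
    (hpos : ∀ x, P₀ x = x → c * ‖x‖ ^ 2 ≤ RCLike.re ⟪H x, Δ₁ (H x)⟫_ℂ) (dV : F → F)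
    {h₁ hst ℓ ρ r : ℝ} (hh₁ : 0 ≤ h₁) (hhst : 0 ≤ hst) (hℓ : 0 ≤ ℓ) (hρ0 : 0 < ρ)
    (hH : ∀ x : E, ‖H x‖ ≤ h₁ * ‖x‖) (hHst : ∀ z : F, ‖Hst z‖ ≤ hst * ‖z‖) (hdV0 : dV 0 = 0)
    (hdV : ∀ u v : F, ‖u‖ ≤ ρ → ‖v‖ ≤ ρ → ‖dV u - dV v‖ ≤ ℓ * ‖u - v‖)
    (hA : ∀ u : F, ‖u‖ < ρ → AnalyticAt ℂ dV u)
    (hρ : h₁ * (3 * r) ≤ ρ) (hsm1 : c⁻¹ * hst * ℓ * h₁ ≤ 1 / 2) :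
    ∃ Kinv : E →L[ℂ] E, ((∀ x, Kinv (P₀ (Hst (Δ₁ (H (P₀ x))))) = P₀ x) ∧
        (∀ x, P₀ (Hst (Δ₁ (H (P₀ (Kinv x))))) = P₀ x) ∧ (∀ x, Kinv (P₀ x) = Kinv x) ∧
        (∀ x, P₀ (Kinv x) = Kinv x) ∧ ∀ x, ‖Kinv x‖ ≤ c⁻¹ * ‖P₀ x‖) ∧
      (∀ z : F, ‖Kinv (P₀ (Hst z))‖ ≤ c⁻¹ * hst * ‖z‖) ∧
      ∃ Bsol : F → E,
        (∀ J : F, ‖Kinv (P₀ (Hst J))‖ < r → AnalyticAt ℂ Bsol J) ∧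
        ∀ J : F, ‖Kinv (P₀ (Hst J))‖ < r →
          ‖Bsol J‖ ≤ 2 * ‖Kinv (P₀ (Hst J))‖ ∧
            Bsol J + Kinv (P₀ (Hst (dV (H (Bsol J))))) = -(Kinv (P₀ (Hst J))) := by
  haveI : CompleteSpace E := FiniteDimensional.complete ℂ E
  obtain ⟨Kinv, hKl, hKr, hKP, hPK, hbd⟩ := exists_inverse_of_pos P₀ hP2 hPsa H Hst hadj Δ₁ hc hpos
  have hKop : ∀ z : F, ‖Kinv (P₀ (Hst z))‖ ≤ c⁻¹ * hst * ‖z‖ :=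
    kinv_comp_bound P₀ hP2 hPsa Hst Kinv hc hbd hHst
  have hκ₁ : 0 ≤ c⁻¹ * hst := mul_nonneg (inv_nonneg.mpr hc.le) hhst
  obtain ⟨Bsol, hBa, hB⟩ :=
    B16Prop1IVAnalytic.prop1IV_analytic_in_J P₀ Kinv H Hst dV hκ₁ hh₁ hℓ hρ0 hKop hH hdV0 hdV hA hρ hsm1
  exact ⟨Kinv, ⟨hKl, hKr, hKP, hPK, hbd⟩, hKop, Bsol, hBa, hB⟩

/-! ## §3. (1.40)/(1.41) p. 367 in the complex model with the inverse DERIVED -/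

/-- **(1.40) p. 367 — *«exactly one solution B′_Λ(B̃′), which is an analytic function of the 𝔤ᶜ-valued small field
B̃′»*, inverse from (1.9).**  `…B16Ineq141Solution.exists_analytic_solution140` with `Kinv`, `hKop` DISCHARGED
(`κ₁ = c⁻¹·hst`): from the (1.9) positivity on the gauge subspace, `P₀` idempotent symmetric, `H*` the adjoint of `H`,
`‖H‖ ≦ h₁`, `‖H*‖ ≦ hst`, `‖Δ₁Hx‖ ≦ b‖x‖`, Proposition 4 [15] (`dV 0 = 0`, `ℓ`-Lipschitz and analytic), the printed-shape
room and smallness conditions: a bounded inverse `Kinv` with the printed bound and a map `B̃′ ↦ B′_Λ(B̃′)`, `ℂ`-analytic on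
`‖B̃′‖ < r`, solving (1.40) `B′ + Kinv P₀ H* dV(H B′ + H B̃′) = −Kinv P₀ H* Δ₁ H B̃′` with `‖B′_Λ(B̃′)‖ ≦ 2c⁻¹hst·b‖B̃′‖`.
[cite: Balaban1989LargeFieldII, (1.40)–(1.41) p.367; p.359 (the inverse); (1.9) p.358] -/
theorem exists_analytic_solution140_of_pos (P₀ : E →L[ℂ] E) (hP2 : ∀ x, P₀ (P₀ x) = P₀ x)
    (hPsa : ∀ x y, ⟪P₀ x, y⟫_ℂ = ⟪x, P₀ y⟫_ℂ) (H : E →L[ℂ] F) (Hst : F →L[ℂ] E)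
    (hadj : ∀ (x : E) (y : F), ⟪H x, y⟫_ℂ = ⟪x, Hst y⟫_ℂ) (Δ₁ : F →L[ℂ] F) {c : ℝ} (hc : 0 < c)
    (hpos : ∀ x, P₀ x = x → c * ‖x‖ ^ 2 ≤ RCLike.re ⟪H x, Δ₁ (H x)⟫_ℂ) (dV : F → F)
    {h₁ hst b ℓ ρ r : ℝ} (hh₁ : 0 ≤ h₁) (hhst : 0 ≤ hst) (hb : 0 ≤ b) (hℓ : 0 ≤ ℓ) (hρ0 : 0 < ρ)
    (hH : ∀ x : E, ‖H x‖ ≤ h₁ * ‖x‖) (hHst : ∀ z : F, ‖Hst z‖ ≤ hst * ‖z‖)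
    (hΔ : ∀ x : E, ‖Δ₁ (H x)‖ ≤ b * ‖x‖) (hdV0 : dV 0 = 0)
    (hdV : ∀ u v : F, ‖u‖ ≤ ρ → ‖v‖ ≤ ρ → ‖dV u - dV v‖ ≤ ℓ * ‖u - v‖)
    (hA : ∀ u : F, ‖u‖ < ρ → AnalyticAt ℂ dV u)
    (hρ : h₁ * ((2 * (c⁻¹ * hst) * b + 2) * r) ≤ ρ) (hsm1 : c⁻¹ * hst * ℓ * h₁ ≤ 1 / 2)
    (hsm2 : ℓ * h₁ * (2 * (c⁻¹ * hst) * b + 1) ≤ b) :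
    ∃ Kinv : E →L[ℂ] E, ((∀ x, Kinv (P₀ (Hst (Δ₁ (H (P₀ x))))) = P₀ x) ∧
        (∀ x, P₀ (Hst (Δ₁ (H (P₀ (Kinv x))))) = P₀ x) ∧ (∀ x, Kinv (P₀ x) = Kinv x) ∧
        (∀ x, P₀ (Kinv x) = Kinv x) ∧ ∀ x, ‖Kinv x‖ ≤ c⁻¹ * ‖P₀ x‖) ∧
      ∃ sol : E → E, AnalyticOnNhd ℂ sol (ball (0 : E) r) ∧
        ∀ Bt : E, ‖Bt‖ < r → ‖sol Bt‖ ≤ 2 * (c⁻¹ * hst) * b * ‖Bt‖ ∧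
          sol Bt + Kinv (P₀ (Hst (dV (H (sol Bt) + H Bt)))) = -(Kinv (P₀ (Hst (Δ₁ (H Bt))))) := by
  haveI : CompleteSpace E := FiniteDimensional.complete ℂ E
  obtain ⟨Kinv, hKl, hKr, hKP, hPK, hbd⟩ := exists_inverse_of_pos P₀ hP2 hPsa H Hst hadj Δ₁ hc hpos
  have hKop : ∀ z : F, ‖Kinv (P₀ (Hst z))‖ ≤ c⁻¹ * hst * ‖z‖ :=
    kinv_comp_bound P₀ hP2 hPsa Hst Kinv hc hbd hHst
  have hκ₁ : 0 ≤ c⁻¹ * hst := mul_nonneg (inv_nonneg.mpr hc.le) hhst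
  obtain ⟨sol, hsa, hs⟩ := B16Ineq141Solution.exists_analytic_solution140 P₀ Kinv H Hst Δ₁ dV hκ₁ hh₁ hb hℓ hρ0
    hKop hH hΔ hdV0 hdV hA hρ hsm1 hsm2
  exact ⟨Kinv, ⟨hKl, hKr, hKP, hPK, hbd⟩, sol, hsa, hs⟩

omit [InnerProductSpace ℂ E] [FiniteDimensional ℂ E] [NormedAddCommGroup F] [InnerProductSpace ℂ F] in
/-- Bookkeeping of the (1.41) constant with the inverse derived: `c = γ₀/(2d(100M)⁵)` ((1.9), so `c⁻¹ =
2d(100M)⁵γ₀⁻¹` = *«the inverse is bounded by γ₀⁻¹2d(100M)⁵»*) and `‖H*‖·‖Δ₁H‖ ≦ B₃²` (print's `B₃²` in (1.41)) give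
`(c⁻¹·hst)·b·‖B̃′‖ ≦ 2d(100M)⁵γ₀⁻¹·(B₃²‖B̃′‖)` — the right-hand-side bound whose double is (1.41).
[cite: Balaban1989LargeFieldII, (1.41) p.367; p.359] -/
theorem rhs141_bound {c hst b γ₀ M B₃ : ℝ} {d : ℕ} (hc : 0 < c) (hcdef : c = γ₀ / (2 * d * (100 * M) ^ 5))
    (hB : hst * b ≤ B₃ ^ 2) (Bt : E) :
    c⁻¹ * hst * b * ‖Bt‖ ≤ 2 * d * (100 * M) ^ 5 * γ₀⁻¹ * (B₃ ^ 2 * ‖Bt‖) := by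
  have hcinv : c⁻¹ = 2 * d * (100 * M) ^ 5 * γ₀⁻¹ := by
    rw [hcdef, inv_div, div_eq_mul_inv]
  have h1 : c⁻¹ * hst * b * ‖Bt‖ = c⁻¹ * ((hst * b) * ‖Bt‖) := by ring
  rw [h1, hcinv]
  have h2d : (0 : ℝ) ≤ 2 * d * (100 * M) ^ 5 * γ₀⁻¹ := by rw [← hcinv]; exact inv_nonneg.mpr hc.le
  exact mul_le_mul_of_nonneg_left (mul_le_mul_of_nonneg_right hB (norm_nonneg _)) h2d

/-- **«Eq. (1.40) has exactly one solution B′_Λ(B̃′) … satisfying the bound (1.41)» p. 367, complex model, inverse from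
(1.9).**  `…B16Ineq141Solution.exactlyOne141` with `Kinv`, `hKop` DISCHARGED: from the (1.9) positivity
`c‖B′‖² ≦ re ⟨HB′, Δ₁HB′⟩` on the gauge subspace with `c = γ₀/(2d(100M)⁵)`, `P₀` idempotent symmetric, `H*` the adjoint
of `H`, `‖H‖ ≦ h₁`, `‖H*‖ ≦ hst`, `‖Δ₁Hx‖ ≦ b‖x‖` with `hst·b ≦ B₃²`, Proposition 4 [15] and the printed-shape room /
smallness conditions: a bounded inverse `Kinv` with the printed bound, and for every `‖B̃′‖ ≦ r` a solution `B′` of (1.40)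
satisfying **(1.41) AS TYPED** (`B16Sect1Statements.Ineq141 ‖B′‖ ‖B̃′‖ d M γ₀ B₃`, by `ineq141_of_twice` BY NAME) and
`‖B′‖ ≦ 2c⁻¹hst·b‖B̃′‖`, any two solutions in the ball `‖B′‖ ≦ (2c⁻¹hst·b + 1)r` being equal.
[cite: Balaban1989LargeFieldII, (1.40)–(1.41) p.367; p.359 (the inverse); (1.9) p.358; Balaban1985Variational, Prop. 4] -/
theorem exactlyOne141_of_pos (P₀ : E →L[ℂ] E) (hP2 : ∀ x, P₀ (P₀ x) = P₀ x)
    (hPsa : ∀ x y, ⟪P₀ x, y⟫_ℂ = ⟪x, P₀ y⟫_ℂ) (H : E →L[ℂ] F) (Hst : F →L[ℂ] E)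
    (hadj : ∀ (x : E) (y : F), ⟪H x, y⟫_ℂ = ⟪x, Hst y⟫_ℂ) (Δ₁ : F →L[ℂ] F) {c γ₀ M B₃ : ℝ} {d : ℕ}
    (hc : 0 < c) (hcdef : c = γ₀ / (2 * d * (100 * M) ^ 5))
    (hpos : ∀ x, P₀ x = x → c * ‖x‖ ^ 2 ≤ RCLike.re ⟪H x, Δ₁ (H x)⟫_ℂ) (dV : F → F)
    {h₁ hst b ℓ ρ r : ℝ} (hh₁ : 0 ≤ h₁) (hhst : 0 ≤ hst) (hb : 0 ≤ b) (hℓ : 0 ≤ ℓ)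
    (hH : ∀ x : E, ‖H x‖ ≤ h₁ * ‖x‖) (hHst : ∀ z : F, ‖Hst z‖ ≤ hst * ‖z‖)
    (hΔ : ∀ x : E, ‖Δ₁ (H x)‖ ≤ b * ‖x‖) (hB : hst * b ≤ B₃ ^ 2) (hdV0 : dV 0 = 0)
    (hdV : ∀ u v : F, ‖u‖ ≤ ρ → ‖v‖ ≤ ρ → ‖dV u - dV v‖ ≤ ℓ * ‖u - v‖)
    (hρ : h₁ * ((2 * (c⁻¹ * hst) * b + 2) * r) ≤ ρ) (hsm1 : c⁻¹ * hst * ℓ * h₁ ≤ 1 / 2)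
    (hsm2 : ℓ * h₁ * (2 * (c⁻¹ * hst) * b + 1) ≤ b) {Bt : E} (hBt : ‖Bt‖ ≤ r) :
    ∃ Kinv : E →L[ℂ] E, ((∀ x, Kinv (P₀ (Hst (Δ₁ (H (P₀ x))))) = P₀ x) ∧
        (∀ x, P₀ (Hst (Δ₁ (H (P₀ (Kinv x))))) = P₀ x) ∧ (∀ x, Kinv (P₀ x) = Kinv x) ∧
        (∀ x, P₀ (Kinv x) = Kinv x) ∧ ∀ x, ‖Kinv x‖ ≤ c⁻¹ * ‖P₀ x‖) ∧
      (∃ x : E, B16Sect1Statements.Ineq141 ‖x‖ ‖Bt‖ d M γ₀ B₃ ∧ ‖x‖ ≤ 2 * (c⁻¹ * hst) * b * ‖Bt‖ ∧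
          x + Kinv (P₀ (Hst (dV (H x + H Bt)))) = -(Kinv (P₀ (Hst (Δ₁ (H Bt)))))) ∧
        ∀ x y : E, ‖x‖ ≤ (2 * (c⁻¹ * hst) * b + 1) * r → ‖y‖ ≤ (2 * (c⁻¹ * hst) * b + 1) * r →
          x + Kinv (P₀ (Hst (dV (H x + H Bt)))) = -(Kinv (P₀ (Hst (Δ₁ (H Bt))))) →
          y + Kinv (P₀ (Hst (dV (H y + H Bt)))) = -(Kinv (P₀ (Hst (Δ₁ (H Bt))))) → x = y := by
  haveI : CompleteSpace E := FiniteDimensional.complete ℂ E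
  obtain ⟨Kinv, hKl, hKr, hKP, hPK, hbd⟩ := exists_inverse_of_pos P₀ hP2 hPsa H Hst hadj Δ₁ hc hpos
  have hKop : ∀ z : F, ‖Kinv (P₀ (Hst z))‖ ≤ c⁻¹ * hst * ‖z‖ :=
    kinv_comp_bound P₀ hP2 hPsa Hst Kinv hc hbd hHst
  have hκ₁ : 0 ≤ c⁻¹ * hst := mul_nonneg (inv_nonneg.mpr hc.le) hhst
  obtain ⟨x, hxn, hxe⟩ := B16Ineq141Solution.exists_solution140 P₀ Kinv H Hst Δ₁ dV hκ₁ hh₁ hb hℓ hKop hH hΔ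
    hdV0 hdV hρ hsm1 hsm2 hBt
  have h141 : B16Sect1Statements.Ineq141 ‖x‖ ‖Bt‖ d M γ₀ B₃ :=
    B16Sect1Statements.ineq141_of_twice (nc := c⁻¹ * hst * b * ‖Bt‖) (by linarith)
      (rhs141_bound hc hcdef hB Bt)
  exact ⟨Kinv, ⟨hKl, hKr, hKP, hPK, hbd⟩, ⟨x, h141, hxn, hxe⟩, fun x y hx hy hxe hye =>
    B16Ineq141Solution.solution140_unique P₀ Kinv H Hst Δ₁ dV hκ₁ hh₁ hℓ hKop hH hdV hρ hsm1 hBt hx hy hxe hye⟩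

end Consumers

end Literature.MathematicalPhysics.QuantumFieldTheory.Balaban1983to89.B16Prop1IVInverseC

end
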